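import Mathlib.AlgebraicTopology.AlternatingFaceMapComplex
import Mathlib.Algebra.Category.ModuleCat.Basic
import Mathlib.LinearAlgebra.Finsupp.LSum
import Mathlib.Analysis.Normed.Module.Convex
import Mathlib.Analysis.Convex.Combination
import HarnessLib

/-!
# Barycentric subdivision of linear (tuple) chains and its diameter bound

A. Hatcher, *Algebraic Topology*, CUP 2002, §2.1, proof of Prop. 2.21 ("Excision", steps
"barycentric subdivision of simplices / of linear chains"), pp. 119–122.

The combinatorial and metric layer of the barycentric-subdivision argument, kept free of any
topology on the vertex type:

* `Literature.TupleChain P n = (Fin (n + 1) → P) →₀ ℤ`: chains of ordered vertex tuples ("linear chains"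
  `[v₀, …, vₙ]`) in a vertex type `P`, with boundary `bd` (`∂[v] = ∑ (-1)ⁱ [v ∘ δᵢ]`, `∂∂ = 0` from
  `AlternatingFaceMapComplex`), cone `cone b` (`b · [v] = [b, v]`, `∂(b·x) = x - b·∂x`);
* for any choice of "barycentres" `bary`, the subdivision operator `sd bary n` (`S[v] = b_v · S ∂[v]`)
  and the operator `sdh bary n` (`T[v] = b_v · ([v] - T∂[v])`), with the identities
  `∂ S = S ∂` (`bd_sd`) and `∂ T + T ∂ = 𝟙 - S` (`bd_sdh_succ`, `bd_sdh_zero`) (Hatcher, p. 121–122);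
* naturality `push_sd`, `push_sdh` under barycentre-preserving maps of vertex types (affine maps);
* supports: tuples of `S x` are cones over tuples of `S` of faces (`mem_support_sd_succ`);
* metric estimates for `P = C` a convex subset of a real normed space with the genuine barycentre
  `baryOf hC`: vertices of `S x` stay in any convex set containing those of `x`
  (`sd_vertices_subset`), and **each tuple of `S[v₀, …, vₖ]` has diameter `≤ k/(k+1)` times that of
  `[v₀, …, vₖ]`** (`diam_sd_single_le`, Hatcher p. 120), iterated: `diam ≤ (k/(k+1))ᵐ d` for `Sᵐ`
  (`diam_sd_iterate_le`); a convex combination of the vertices is within the diameter of each vertex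
  (`dist_affineCombination_le`).

The singular-chain level (`S σ = σ♯ S Δⁿ`, Prop. 2.21) is built on top of this in a separate file.
Everything is definitions with bodies and proved lemmas. [folklore]

## References

* A. Hatcher, *Algebraic Topology*, CUP 2002, §2.1, pp. 119–124.
-/

noncomputable section

open CategoryTheory Simplicial Opposite AlgebraicTopology

universe u

namespace Literature.AlgebraicTopology.SingularHomology

variable (P : Type u)

/-- The simplicial `ℤ`-module freely generated by ordered vertex tuples in `P`:
`n`-simplices are the free `ℤ`-module on `Fin (n + 1) → P`, and a monotone map
`θ : ⦋k⦌ → ⦋n⦌` acts by `v ↦ v ∘ θ`. [folklore] -/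
abbrev tupleSMod : SimplicialObject (ModuleCat.{u} ℤ) where
  obj n := ModuleCat.of ℤ ((Fin (n.unop.len + 1) → P) →₀ ℤ)
  map θ := ModuleCat.ofHom
    (Finsupp.lmapDomain ℤ ℤ (fun v : Fin _ → P => v ∘ (θ.unop.toOrderHom : Fin _ → Fin _)))
  map_id n := by
    ext v : 4
    simp
  map_comp θ θ' := by
    ext v : 4
    simp [Function.comp_assoc]

/-- The chain complex of ordered vertex tuples in `P` (alternating face map complex of
`tupleSMod P`). [folklore] -/
abbrev tupleChainComplex : ChainComplex (ModuleCat.{u} ℤ) ℕ :=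
  AlternatingFaceMapComplex.obj (tupleSMod P)

/-- `n`-chains of ordered vertex tuples: the free `ℤ`-module on `Fin (n + 1) → P`. This is
definitionally the carrier of `(tupleChainComplex P).X n`. [folklore] -/
abbrev TupleChain (n : ℕ) : Type u := (Fin (n + 1) → P) →₀ ℤ

namespace TupleChain

variable {P}
variable {n : ℕ}

/-- The boundary `∂ : Cₙ₊₁ → Cₙ`, `∂[v] = ∑ᵢ (-1)ⁱ [v ∘ δᵢ]`, as a `ℤ`-linear map; by definition the
differential of `tupleChainComplex P`. [folklore] -/
def bd (n : ℕ) : TupleChain P (n + 1) →ₗ[ℤ] TupleChain P n :=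
  (AlternatingFaceMapComplex.objD (tupleSMod P) n).hom

/-- The face maps of `tupleSMod` are `Finsupp.lmapDomain` of `v ↦ v ∘ Fin.succAbove i` (deleting the `i`-th vertex). [folklore] -/
lemma tupleSMod_δ_hom (i : Fin (n + 2)) :
    ((tupleSMod P).δ i).hom =
      Finsupp.lmapDomain ℤ ℤ (fun v : Fin (n + 2) → P => v ∘ Fin.succAbove i) :=
  rfl

/-- The boundary of an elementary tuple chain: `∂[v] = ∑ᵢ (-1)ⁱ [v ∘ δᵢ]` (Hatcher 2002, §2.1). [folklore] -/
lemma bd_single (v : Fin (n + 2) → P) (c : ℤ) :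
    bd n (Finsupp.single v c) =
      ∑ i : Fin (n + 2), (-1 : ℤ) ^ (i : ℕ) • Finsupp.single (v ∘ Fin.succAbove i) c := by
  rw [bd, AlternatingFaceMapComplex.objD, ModuleCat.hom_sum, LinearMap.coe_sum, Finset.sum_apply]
  refine Finset.sum_congr rfl fun i _ => ?_
  rw [ModuleCat.hom_zsmul, LinearMap.smul_apply, tupleSMod_δ_hom, Finsupp.lmapDomain_apply,
    Finsupp.mapDomain_single]

/-- `∂ ∘ ∂ = 0` on tuple chains (Hatcher 2002, Lemma 2.1), from `AlternatingFaceMapComplex.d_squared`. [folklore] -/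
@[simp]
lemma bd_bd (x : TupleChain P (n + 2)) : bd n (bd (n + 1) x) = 0 := by
  have h := congrArg ModuleCat.Hom.hom (AlternatingFaceMapComplex.d_squared (tupleSMod P) n)
  exact congr($h x)

/-- The cone `b · [v₀, …, vₙ] = [b, v₀, …, vₙ]` on tuple chains. [folklore] -/
def cone (b : P) : TupleChain P n →ₗ[ℤ] TupleChain P (n + 1) :=
  Finsupp.lmapDomain ℤ ℤ (fun v : Fin (n + 1) → P => (Fin.cons b v : Fin (n + 2) → P))

/-- The cone of an elementary chain: `b · [v] = [b, v]`. [folklore] -/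
@[simp]
lemma cone_single (b : P) (v : Fin (n + 1) → P) (c : ℤ) :
    cone b (Finsupp.single v c) = Finsupp.single (Fin.cons b v : Fin (n + 2) → P) c := by
  simp [cone]

/-- Deleting the apex of a cone gives back the base: `[b, v] ∘ δ₀ = [v]`. [folklore] -/
lemma cons_comp_succAbove_zero (b : P) (v : Fin (n + 1) → P) :
    (Fin.cons b v : Fin (n + 2) → P) ∘ Fin.succAbove 0 = v := by
  ext j
  simp

/-- Deleting a later vertex of a cone is the cone on the deleted base: `[b, v] ∘ δᵢ₊₁ = [b, v ∘ δᵢ]`. [folklore] -/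
lemma cons_comp_succAbove_succ (b : P) (v : Fin (n + 2) → P) (i : Fin (n + 2)) :
    (Fin.cons b v : Fin (n + 3) → P) ∘ Fin.succAbove i.succ =
      (Fin.cons b (v ∘ Fin.succAbove i) : Fin (n + 2) → P) := by
  ext j
  refine Fin.cases ?_ (fun l => ?_) j
  · simp
  · simp

/-- `[b, v₀] ∘ δ₁ = [b]`; stated with `Fin (0 + 2)` so that it rewrites the `n = 0` instance of
the general boundary formula. [folklore] -/
lemma cons_comp_succAbove_one (b : P) (v : Fin (0 + 1) → P) :
    (Fin.cons b v : Fin (0 + 2) → P) ∘ Fin.succAbove (1 : Fin (0 + 2)) = fun _ => b := by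
  ext j
  have hj : j = 0 := Subsingleton.elim (α := Fin 1) _ _
  subst hj
  rfl

/-- The cone identity in positive degrees: `∂ (b · x) = x - b · ∂ x`. [folklore] -/
lemma bd_cone_succ (b : P) (x : TupleChain P (n + 1)) :
    bd (n + 1) (cone b x) = x - cone b (bd n x) := by
  induction x using Finsupp.induction_linear with
  | zero => simp
  | add x y hx hy => simp only [map_add, hx, hy]; abel
  | single v c =>
    rw [cone_single, bd_single, Fin.sum_univ_succ, bd_single, map_sum]
    simp only [Fin.val_zero, pow_zero, one_smul, cons_comp_succAbove_zero, Fin.val_succ,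
      pow_succ, mul_neg, mul_one, neg_smul, cons_comp_succAbove_succ, map_zsmul, cone_single,
      Finset.sum_neg_distrib]
    abel

/-- The cone identity in degree `0` on an elementary chain: `∂ (b · [v]) = [v] - [b]`. [folklore] -/
lemma bd_cone_single_zero (b : P) (v : Fin (0 + 1) → P) (c : ℤ) :
    bd 0 (cone b (Finsupp.single v c)) =
      Finsupp.single v c - Finsupp.single (fun _ => b) c := by
  rw [cone_single, bd_single, Fin.sum_univ_two]
  rw [cons_comp_succAbove_zero, cons_comp_succAbove_one]
  simp only [Fin.val_zero, pow_zero, one_smul, Fin.val_one, pow_one, neg_smul]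
  abel

variable (bary : (n : ℕ) → (Fin (n + 1) → P) → P)

/-- Barycentric subdivision `S` on tuple chains, `S [v] = b_v · S (∂ [v])`, `S = id` in degree
`0`, for a given choice of "barycentres" `bary`. [folklore] -/
def sd : (n : ℕ) → TupleChain P n →ₗ[ℤ] TupleChain P n
  | 0 => LinearMap.id
  | n + 1 => Finsupp.lsum ℤ fun v =>
      LinearMap.id.smulRight (cone (bary _ v) (sd n (bd n (Finsupp.single v 1))))

/-- `S = 𝟙` in degree `0` (Hatcher 2002, §2.1). [folklore] -/
@[simp]
lemma sd_zero (x : TupleChain P 0) : sd bary 0 x = x := rfl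

/-- `S [v] = c • b_v · S(∂[v])` on an elementary chain of positive degree (Hatcher 2002, §2.1). [folklore] -/
lemma sd_succ_single (v : Fin (n + 2) → P) (c : ℤ) :
    sd bary (n + 1) (Finsupp.single v c) =
      c • cone (bary _ v) (sd bary n (bd n (Finsupp.single v 1))) := by
  simp [sd]

/-- The chain homotopy `T` from `𝟙` to `S`: `T [v] = b_v · ([v] - T ∂ [v])`, and in degree `0`
`T [v₀] = [v₀, v₀]`. [folklore] -/
def sdh : (n : ℕ) → TupleChain P n →ₗ[ℤ] TupleChain P (n + 1)
  | 0 => Finsupp.lsum ℤ fun v =>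
      LinearMap.id.smulRight (Finsupp.single (Fin.cons (v 0) v : Fin 2 → P) 1)
  | n + 1 => Finsupp.lsum ℤ fun v =>
      LinearMap.id.smulRight
        (cone (bary _ v) (Finsupp.single v 1 - sdh n (bd n (Finsupp.single v 1))))

/-- `T [v₀] = [v₀, v₀]` in degree `0` (Hatcher 2002, §2.1, where `T` is defined by `T λ = b_λ(λ - T∂λ)` and `T = 0` in degree `-1`). [folklore] -/
lemma sdh_zero_single (v : Fin 1 → P) (c : ℤ) :
    sdh bary 0 (Finsupp.single v c) = Finsupp.single (Fin.cons (v 0) v : Fin 2 → P) c := by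
  simp [sdh]

/-- `T [v] = c • b_v · ([v] - T ∂[v])` in positive degree (Hatcher 2002, §2.1). [folklore] -/
lemma sdh_succ_single (v : Fin (n + 2) → P) (c : ℤ) :
    sdh bary (n + 1) (Finsupp.single v c) =
      c • cone (bary _ v) (Finsupp.single v 1 - sdh bary n (bd n (Finsupp.single v 1))) := by
  simp [sdh]

/-- `S` is a chain map: `∂ S = S ∂`. [folklore] -/
lemma bd_sd : ∀ (n : ℕ) (x : TupleChain P (n + 1)), bd n (sd bary (n + 1) x) = sd bary n (bd n x)
  | 0, x => by
    induction x using Finsupp.induction_linear with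
    | zero => simp
    | add x y hx hy =>
      simp only [map_add] at hx hy ⊢
      rw [hx, hy]
    | single v c =>
      rw [sd_succ_single, sd_zero, sd_zero, map_zsmul, ← Finsupp.smul_single_one v c,
        map_zsmul (bd 0) c]
      congr 1
      rw [bd_single, Fin.sum_univ_two, map_add, map_add]
      simp only [Fin.val_zero, pow_zero, one_smul, Fin.val_one, pow_one, neg_smul, map_neg,
        bd_cone_single_zero]
      abel
  | n + 1, x => by
    induction x using Finsupp.induction_linear with
    | zero => simp
    | add x y hx hy =>
      simp only [map_add] at hx hy ⊢
      rw [hx, hy]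
    | single v c =>
      rw [sd_succ_single, map_zsmul, bd_cone_succ, bd_sd n, bd_bd, map_zero, map_zero, sub_zero,
        ← map_zsmul, ← map_zsmul, Finsupp.smul_single_one]

/-- `∂ T = 0` in degree `0` (there `S = 𝟙`). [folklore] -/
lemma bd_sdh_zero (x : TupleChain P 0) : bd 0 (sdh bary 0 x) = 0 := by
  induction x using Finsupp.induction_linear with
  | zero => simp
  | add x y hx hy => simp only [map_add, hx, hy, add_zero]
  | single v c =>
    rw [sdh_zero_single, ← cone_single, bd_cone_single_zero, sub_eq_zero]
    congr 1
    ext j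
    have hj : j = 0 := Subsingleton.elim (α := Fin 1) _ _
    rw [hj]

/-- The chain homotopy identity `∂ T + T ∂ = 𝟙 - S` (positive degrees). [folklore] -/
lemma bd_sdh_succ : ∀ (n : ℕ) (x : TupleChain P (n + 1)),
    bd (n + 1) (sdh bary (n + 1) x) + sdh bary n (bd n x) = x - sd bary (n + 1) x
  | 0, x => by
    induction x using Finsupp.induction_linear with
    | zero => simp
    | add x y hx hy =>
      simp only [map_add] at hx hy ⊢
      rw [add_add_add_comm, hx, hy]
      abel
    | single v c =>
      rw [← Finsupp.smul_single_one v c, map_zsmul, map_zsmul, map_zsmul, map_zsmul, map_zsmul,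
        ← smul_add, ← smul_sub]
      congr 1
      rw [sdh_succ_single, one_smul, bd_cone_succ, map_sub, bd_sdh_zero, sub_zero,
        sd_succ_single, one_smul, sd_zero]
      abel
  | n + 1, x => by
    induction x using Finsupp.induction_linear with
    | zero => simp
    | add x y hx hy =>
      simp only [map_add] at hx hy ⊢
      rw [add_add_add_comm, hx, hy]
      abel
    | single v c =>
      rw [← Finsupp.smul_single_one v c, map_zsmul, map_zsmul, map_zsmul, map_zsmul, map_zsmul,
        ← smul_add, ← smul_sub]
      congr 1
      have ih := bd_sdh_succ n (bd (n + 1) (Finsupp.single v 1))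
      rw [bd_bd, map_zero, add_zero] at ih
      rw [sdh_succ_single, one_smul, bd_cone_succ, map_sub, ih, sd_succ_single, one_smul,
        sub_sub_cancel]
      abel

/-! ### Naturality under maps of vertex types -/

section Push

variable {P' : Type u} (g : P → P')

/-- Push-forward of tuple chains along a map of vertices, `[v₀, …, vₙ] ↦ [g v₀, …, g vₙ]`
(Hatcher 2002, §2.1: `f♯` on linear chains for an affine `f`). [folklore] -/
def push (n : ℕ) : TupleChain P n →ₗ[ℤ] TupleChain P' n :=
  Finsupp.lmapDomain ℤ ℤ (fun w : Fin (n + 1) → P => g ∘ w)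

/-- Push-forward of an elementary chain. [folklore] -/
@[simp]
lemma push_single (n : ℕ) (w : Fin (n + 1) → P) (c : ℤ) :
    push g n (Finsupp.single w c) = Finsupp.single (g ∘ w) c := by
  simp [push]

/-- Push-forward commutes with the boundary. [folklore] -/
lemma push_bd (n : ℕ) (x : TupleChain P (n + 1)) : push g n (bd n x) = bd n (push g (n + 1) x) := by
  induction x using Finsupp.induction_linear with
  | zero => simp
  | add x y hx hy => simp only [map_add, hx, hy]
  | single v c =>
    rw [bd_single, map_sum, push_single, bd_single]
    refine Finset.sum_congr rfl fun i _ => ?_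
    rw [map_zsmul, push_single]
    rfl

/-- Push-forward commutes with cones. [folklore] -/
lemma push_cone (n : ℕ) (b : P) (x : TupleChain P n) :
    push g (n + 1) (cone b x) = cone (g b) (push g n x) := by
  induction x using Finsupp.induction_linear with
  | zero => simp
  | add x y hx hy => simp only [map_add, hx, hy]
  | single v c =>
    rw [cone_single, push_single, push_single, cone_single]
    congr 1
    ext j
    refine Fin.cases ?_ (fun l => ?_) j <;> simp

variable (bary' : (n : ℕ) → (Fin (n + 1) → P') → P')

/-- Push-forward along a barycentre-preserving map commutes with subdivision
(Hatcher 2002, §2.1: naturality of `S` for linear chains under affine maps). [folklore] -/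
lemma push_sd (hg : ∀ (k : ℕ) (w : Fin (k + 1) → P), g (bary k w) = bary' k (g ∘ w)) :
    ∀ (n : ℕ) (x : TupleChain P n), push g n (sd bary n x) = sd bary' n (push g n x)
  | 0, x => by simp
  | n + 1, x => by
    induction x using Finsupp.induction_linear with
    | zero => simp
    | add x y hx hy => simp only [map_add, hx, hy]
    | single v c =>
      rw [sd_succ_single, push_single, sd_succ_single, map_zsmul, push_cone, hg, push_sd hg n,
        push_bd, push_single]

/-- Push-forward along a barycentre-preserving map commutes with the subdivision homotopy `T`
(Hatcher 2002, §2.1). [folklore] -/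
lemma push_sdh (hg : ∀ (k : ℕ) (w : Fin (k + 1) → P), g (bary k w) = bary' k (g ∘ w)) :
    ∀ (n : ℕ) (x : TupleChain P n), push g (n + 1) (sdh bary n x) = sdh bary' n (push g n x)
  | 0, x => by
    induction x using Finsupp.induction_linear with
    | zero => simp
    | add x y hx hy => simp only [map_add, hx, hy]
    | single v c =>
      rw [sdh_zero_single, push_single, push_single, sdh_zero_single]
      congr 1
      ext j
      refine Fin.cases ?_ (fun l => ?_) j <;> simp
  | n + 1, x => by
    induction x using Finsupp.induction_linear with
    | zero => simp
    | add x y hx hy => simp only [map_add, hx, hy]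
    | single v c =>
      rw [sdh_succ_single, push_single, sdh_succ_single, map_zsmul, push_cone, hg, map_sub,
        push_sdh hg n, push_bd, push_single]

end Push

/-! ### Supports of subdivided chains -/

section Support

/-- `S (c • [v]) = c • S [v]`. [folklore] -/
lemma sd_single_eq_smul (n : ℕ) (v : Fin (n + 1) → P) (c : ℤ) :
    sd bary n (Finsupp.single v c) = c • sd bary n (Finsupp.single v 1) := by
  rw [← map_zsmul, Finsupp.smul_single_one]

variable [DecidableEq P]

/-- The tuples of `S x` come from the tuples of `S [v]` for `v` a tuple of `x`. [folklore] -/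
lemma mem_support_sd {n : ℕ} {x : TupleChain P n} {w : Fin (n + 1) → P}
    (hw : w ∈ (sd bary n x).support) :
    ∃ v ∈ x.support, w ∈ (sd bary n (Finsupp.single v 1)).support := by
  rw [← Finsupp.sum_single x, Finsupp.sum, map_sum] at hw
  obtain ⟨v, hv, hw⟩ := Finset.mem_biUnion.mp (Finsupp.support_finsetSum hw)
  rw [sd_single_eq_smul] at hw
  exact ⟨v, hv, Finsupp.support_smul hw⟩

/-- The tuples of `S [v₀, …, vₙ₊₁]` are cones `[b, u₀, …, uₙ]` with apex the barycentre `b` of `v`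
over tuples `u` of `S [face of v]`. [folklore] -/
lemma mem_support_sd_succ {n : ℕ} {v : Fin (n + 2) → P} {c : ℤ} {w : Fin (n + 2) → P}
    (hw : w ∈ (sd bary (n + 1) (Finsupp.single v c)).support) :
    ∃ (i : Fin (n + 2)) (u : Fin (n + 1) → P),
      u ∈ (sd bary n (Finsupp.single (v ∘ Fin.succAbove i) 1)).support ∧
        w = Fin.cons (bary _ v) u := by
  rw [sd_succ_single] at hw
  have hw' := Finsupp.support_smul hw
  rw [cone] at hw'
  obtain ⟨u, hu, rfl⟩ := Finset.mem_image.mp (Finsupp.mapDomain_support hw')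
  obtain ⟨v', hv', hu'⟩ := mem_support_sd bary hu
  rw [bd_single] at hv'
  obtain ⟨i, _, hi⟩ := Finset.mem_biUnion.mp (Finsupp.support_finsetSum hv')
  have hv'i : v' = v ∘ Fin.succAbove i := by
    have := Finsupp.support_smul hi
    exact Finset.mem_singleton.mp (Finsupp.support_single_subset this)
  exact ⟨i, u, hv'i ▸ hu', rfl⟩

end Support

/-! ### Metric estimates for barycentric subdivision in a normed space -/

section Metric

open Metric

variable {E : Type u} [NormedAddCommGroup E] [NormedSpace ℝ E] {C : Set E}

/-- The set of vertices `{v₀, …, vₖ} ⊆ E` of a tuple of points of `C ⊆ E`. [folklore] -/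
def vrange {k : ℕ} (w : Fin (k + 1) → C) : Set E := Set.range fun i => (w i : E)

omit [NormedSpace ℝ E] in
/-- The vertex set of a tuple is finite, hence bounded. [folklore] -/
lemma isBounded_vrange {k : ℕ} (w : Fin (k + 1) → C) : Bornology.IsBounded (vrange w) :=
  (Set.finite_range _).isBounded

omit [NormedAddCommGroup E] [NormedSpace ℝ E] in
/-- Each vertex belongs to the vertex set. [folklore] -/
lemma mem_vrange {k : ℕ} (w : Fin (k + 1) → C) (i : Fin (k + 1)) : (w i : E) ∈ vrange w := ⟨i, rfl⟩

omit [NormedSpace ℝ E] in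
/-- Distances between vertices are bounded by the diameter of the vertex set. [folklore] -/
lemma dist_le_diam_vrange {k : ℕ} (w : Fin (k + 1) → C) (i j : Fin (k + 1)) :
    dist (w i : E) (w j) ≤ diam (vrange w) :=
  dist_le_diam_of_mem (isBounded_vrange w) (mem_vrange w i) (mem_vrange w j)

omit [NormedAddCommGroup E] [NormedSpace ℝ E] in
/-- The vertex set of a face is contained in the vertex set. [folklore] -/
lemma vrange_comp_subset {k l : ℕ} (w : Fin (k + 1) → C) (f : Fin (l + 1) → Fin (k + 1)) :
    vrange (w ∘ f) ⊆ vrange w := by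
  rintro _ ⟨i, rfl⟩
  exact ⟨f i, rfl⟩

variable (hC : Convex ℝ C)

/-- The barycentre `(k+1)⁻¹ ∑ᵢ wᵢ` of a tuple of points of a convex set `C`, as a point of `C`
(Hatcher 2002, §2.1, "barycentric subdivision": the barycentre of `[v₀, …, vₖ]`). [folklore] -/
def baryOf (k : ℕ) (w : Fin (k + 1) → C) : C :=
  ⟨∑ i, ((k : ℝ) + 1)⁻¹ • (w i : E),
    hC.sum_mem (fun _ _ => by positivity)
      (by rw [Finset.sum_const, Finset.card_univ, Fintype.card_fin, nsmul_eq_mul]; push_cast; field_simp)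
      (fun i _ => (w i).2)⟩

/-- The barycentre as a vector: `(k+1)⁻¹ ∑ᵢ wᵢ`. [folklore] -/
lemma coe_baryOf (k : ℕ) (w : Fin (k + 1) → C) :
    (baryOf hC k w : E) = ∑ i, ((k : ℝ) + 1)⁻¹ • (w i : E) := rfl

/-- The barycentre of `[v₀, …, vₖ₊₁]` is within `(k+1)/(k+2)` of the diameter from each vertex
(Hatcher 2002, §2.1, proof that subdivided simplices have diameter `≤ n/(n+1)` of the original). [folklore] -/
lemma dist_baryOf_le {k : ℕ} (v : Fin (k + 2) → C) (j : Fin (k + 2)) :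
    dist (baryOf hC (k + 1) v : E) (v j) ≤ ((k : ℝ) + 1) / ((k : ℝ) + 2) * diam (vrange v) := by
  set D := diam (vrange v) with hD
  set c : ℝ := (((k + 1 : ℕ) : ℝ) + 1)⁻¹ with hc
  have hc2 : c = ((k : ℝ) + 2)⁻¹ := by
    rw [hc]; push_cast; ring_nf
  have hcpos : 0 < c := by rw [hc2]; positivity
  have hcsum : ∑ _i : Fin (k + 2), c = 1 := by
    rw [Finset.sum_const, Finset.card_univ, Fintype.card_fin, nsmul_eq_mul, hc2]
    push_cast
    field_simp
  have e : (baryOf hC (k + 1) v : E) - v j = ∑ i, c • ((v i : E) - v j) := by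
    rw [coe_baryOf]
    simp only [← hc, smul_sub, Finset.sum_sub_distrib, ← Finset.sum_smul, hcsum, one_smul]
  have key : ∑ i, ‖(v i : E) - v j‖ ≤ ((k : ℝ) + 1) * D := by
    rw [← Finset.add_sum_erase _ _ (Finset.mem_univ j), sub_self, norm_zero, zero_add]
    calc ∑ i ∈ Finset.univ.erase j, ‖(v i : E) - v j‖
        ≤ ∑ _i ∈ Finset.univ.erase j, D := Finset.sum_le_sum fun i _ => by
          rw [← dist_eq_norm]; exact dist_le_diam_vrange v i j
      _ = ((k : ℝ) + 1) * D := by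
          rw [Finset.sum_const, Finset.card_erase_of_mem (Finset.mem_univ j), Finset.card_univ,
            Fintype.card_fin, nsmul_eq_mul]
          push_cast
          ring
  rw [dist_eq_norm, e]
  calc ‖∑ i, c • ((v i : E) - v j)‖ ≤ ∑ i, ‖c • ((v i : E) - v j)‖ := norm_sum_le _ _
    _ = c * ∑ i, ‖(v i : E) - v j‖ := by
        rw [Finset.mul_sum]
        refine Finset.sum_congr rfl fun i _ => ?_
        rw [norm_smul, Real.norm_of_nonneg hcpos.le]
    _ ≤ c * (((k : ℝ) + 1) * D) := by gcongr
    _ = ((k : ℝ) + 1) / ((k : ℝ) + 2) * D := by rw [hc2]; ring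

/-- Every point of the simplex spanned by `[v₀, …, vₖ₊₁]` is within `(k+1)/(k+2)` of the diameter
from the barycentre (Hatcher 2002, §2.1). [folklore] -/
lemma dist_baryOf_le_of_mem_convexHull {k : ℕ} (v : Fin (k + 2) → C) {x : E}
    (hx : x ∈ convexHull ℝ (vrange v)) :
    dist (baryOf hC (k + 1) v : E) x ≤ ((k : ℝ) + 1) / ((k : ℝ) + 2) * diam (vrange v) := by
  have hsub : vrange v ⊆ closedBall (baryOf hC (k + 1) v : E)
      (((k : ℝ) + 1) / ((k : ℝ) + 2) * diam (vrange v)) := by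
    rintro _ ⟨j, rfl⟩
    rw [mem_closedBall, dist_comm]
    exact dist_baryOf_le hC v j
  have h := convexHull_min hsub (convex_closedBall _ _) hx
  rw [mem_closedBall, dist_comm] at h
  exact h

/-- The barycentre lies in the convex hull of the vertices. [folklore] -/
lemma baryOf_mem_convexHull {k : ℕ} (w : Fin (k + 1) → C) :
    (baryOf hC k w : E) ∈ convexHull ℝ (vrange w) := by
  rw [coe_baryOf]
  refine (convex_convexHull ℝ _).sum_mem (fun _ _ => by positivity) ?_
    (fun i _ => subset_convexHull ℝ _ (mem_vrange w i))
  rw [Finset.sum_const, Finset.card_univ, Fintype.card_fin, nsmul_eq_mul]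
  push_cast
  field_simp

variable [DecidableEq E]

/-- Vertices of subdivided tuples stay in any convex set containing the original vertices
(Hatcher 2002, §2.1: `S` maps linear chains in a convex set to linear chains in it). [folklore] -/
lemma sd_vertices_subset {K : Set E} (hK : Convex ℝ K) :
    ∀ (k : ℕ) (c : TupleChain C k), (∀ w ∈ c.support, ∀ i, (w i : E) ∈ K) →
      ∀ w' ∈ (sd (baryOf hC) k c).support, ∀ i, (w' i : E) ∈ K
  | 0, c, h, w', hw', i => h w' hw' i
  | k + 1, c, h, w', hw', i => by
    obtain ⟨v, hv, hw'⟩ := mem_support_sd (baryOf hC) hw'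
    obtain ⟨i', u, hu, rfl⟩ := mem_support_sd_succ (baryOf hC) hw'
    refine Fin.cases ?_ (fun l => ?_) i
    · rw [Fin.cons_zero, coe_baryOf]
      refine hK.sum_mem (fun _ _ => by positivity) ?_ (fun j _ => h v hv j)
      rw [Finset.sum_const, Finset.card_univ, Fintype.card_fin, nsmul_eq_mul]
      push_cast
      field_simp
    · rw [Fin.cons_succ]
      refine sd_vertices_subset hK k (Finsupp.single (v ∘ Fin.succAbove i') 1) ?_ u hu l
      intro w hw j
      have hw : w = v ∘ Fin.succAbove i' :=
        Finset.mem_singleton.mp (Finsupp.support_single_subset hw)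
      subst hw
      exact h v hv _

omit [NormedSpace ℝ E] [DecidableEq E] in
/-- A tuple with at most one vertex has diameter `0`. [folklore] -/
lemma diam_vrange_fin_one (w : Fin (0 + 1) → C) : diam (vrange w) = 0 := by
  have : vrange w = {(w 0 : E)} := by
    apply Set.eq_singleton_iff_unique_mem.mpr
    refine ⟨mem_vrange w 0, ?_⟩
    rintro _ ⟨i, rfl⟩
    rw [Subsingleton.elim (α := Fin 1) i 0]
  rw [this, diam_singleton]

/-- **Diameter bound for barycentric subdivision** (Hatcher 2002, §2.1, p. 120: each simplex of the
barycentric subdivision of `[v₀, …, vₖ]` has diameter at most `k/(k+1)` times that of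
`[v₀, …, vₖ]`). [folklore] -/
lemma diam_sd_single_le :
    ∀ (k : ℕ) (v : Fin (k + 1) → C) (z : ℤ), ∀ w' ∈ (sd (baryOf hC) k (Finsupp.single v z)).support,
      diam (vrange w') ≤ (k : ℝ) / ((k : ℝ) + 1) * diam (vrange v)
  | 0, v, z, w', hw' => by
    rw [diam_vrange_fin_one, diam_vrange_fin_one]
    simp
  | k + 1, v, z, w', hw' => by
    push_cast
    rw [show (k : ℝ) + 1 + 1 = (k : ℝ) + 2 by ring]
    obtain ⟨i, u, hu, rfl⟩ := mem_support_sd_succ (baryOf hC) hw'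
    set D := diam (vrange v) with hD
    have hD0 : 0 ≤ D := diam_nonneg
    have hratio : ((k : ℝ) + 1) / ((k : ℝ) + 2) * D ≥ 0 := by positivity
    -- vertices of `u` lie in the hull of the vertices of `v`
    have hu_hull : ∀ l, (u l : E) ∈ convexHull ℝ (vrange v) := by
      intro l
      refine sd_vertices_subset hC (convex_convexHull ℝ _) k
        (Finsupp.single (v ∘ Fin.succAbove i) 1) ?_ u hu l
      intro w hw j
      have hw : w = v ∘ Fin.succAbove i :=
        Finset.mem_singleton.mp (Finsupp.support_single_subset hw)
      subst hw
      exact subset_convexHull ℝ _ (mem_vrange v _)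
    -- the diameter of `u` (induction hypothesis)
    have hu_diam : diam (vrange u) ≤ ((k : ℝ) + 1) / ((k : ℝ) + 2) * D := by
      refine (diam_sd_single_le k (v ∘ Fin.succAbove i) 1 u hu).trans ?_
      have h1 : diam (vrange (v ∘ Fin.succAbove i)) ≤ D :=
        diam_mono (vrange_comp_subset v _) (isBounded_vrange v)
      have h2 : (k : ℝ) / ((k : ℝ) + 1) ≤ ((k : ℝ) + 1) / ((k : ℝ) + 2) := by
        rw [div_le_div_iff₀ (by positivity) (by positivity)]
        nlinarith
      calc (k : ℝ) / ((k : ℝ) + 1) * diam (vrange (v ∘ Fin.succAbove i))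
          ≤ (k : ℝ) / ((k : ℝ) + 1) * D := by gcongr
        _ ≤ ((k : ℝ) + 1) / ((k : ℝ) + 2) * D := by gcongr
    have hb : ∀ l, dist (baryOf hC (k + 1) v : E) (u l) ≤ ((k : ℝ) + 1) / ((k : ℝ) + 2) * D :=
      fun l => dist_baryOf_le_of_mem_convexHull hC v (hu_hull l)
    refine diam_le_of_forall_dist_le hratio ?_
    rintro _ ⟨a, rfl⟩ _ ⟨a', rfl⟩
    refine Fin.cases ?_ (fun l => ?_) a <;> refine Fin.cases ?_ (fun l' => ?_) a'
    · simp only [Fin.cons_zero, dist_self]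
      exact hratio
    · simp only [Fin.cons_zero, Fin.cons_succ]
      exact hb l'
    · simp only [Fin.cons_zero, Fin.cons_succ]
      rw [dist_comm]
      exact hb l
    · simp only [Fin.cons_succ]
      exact (dist_le_diam_vrange u l l').trans hu_diam

/-- Diameter bound for the subdivision of a chain: if all tuples of `c` have diameter `≤ d`, all
tuples of `S c` have diameter `≤ k/(k+1) · d` (Hatcher 2002, §2.1). [folklore] -/
lemma diam_sd_le {k : ℕ} {c : TupleChain C k} {d : ℝ}
    (h : ∀ w ∈ c.support, diam (vrange w) ≤ d) :
    ∀ w' ∈ (sd (baryOf hC) k c).support, diam (vrange w') ≤ (k : ℝ) / ((k : ℝ) + 1) * d := by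
  intro w' hw'
  obtain ⟨v, hv, hw'⟩ := mem_support_sd (baryOf hC) hw'
  refine (diam_sd_single_le hC k v 1 w' hw').trans ?_
  gcongr
  exact h v hv

/-- Iterated subdivision shrinks diameters geometrically: tuples of `Sᵐ c` have diameter
`≤ (k/(k+1))ᵐ · d` (Hatcher 2002, §2.1, proof of Prop. 2.21). [folklore] -/
lemma diam_sd_iterate_le {k : ℕ} {d : ℝ} :
    ∀ (m : ℕ) {c : TupleChain C k}, (∀ w ∈ c.support, diam (vrange w) ≤ d) →
      ∀ w' ∈ ((sd (baryOf hC) k)^[m] c).support,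
        diam (vrange w') ≤ ((k : ℝ) / ((k : ℝ) + 1)) ^ m * d
  | 0, c, h, w', hw' => by simpa using h w' hw'
  | m + 1, c, h, w', hw' => by
    rw [Function.iterate_succ_apply'] at hw'
    refine (diam_sd_le hC (diam_sd_iterate_le m h) w' hw').trans_eq ?_
    ring

omit [DecidableEq E] in
/-- A convex combination of the vertices of a tuple is within the diameter of the tuple from each
vertex (the affine simplex spanned by `w` has the same diameter as its vertex set). [folklore] -/
lemma dist_affineCombination_le {k : ℕ} (w : Fin (k + 1) → C) (t : stdSimplex ℝ (Fin (k + 1)))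
    (j : Fin (k + 1)) : dist (∑ i, t i • (w i : E)) (w j) ≤ diam (vrange w) := by
  have hx : ∑ i, t i • (w i : E) ∈ convexHull ℝ (vrange w) :=
    (convex_convexHull ℝ _).sum_mem (fun i _ => t.2.1 i) t.2.2
      (fun i _ => subset_convexHull ℝ _ (mem_vrange w i))
  rw [← convexHull_diam]
  exact dist_le_diam_of_mem (isBounded_convexHull.mpr (isBounded_vrange w)) hx
    (subset_convexHull ℝ _ (mem_vrange w j))

end Metric

end TupleChain

end Literature.AlgebraicTopology.SingularHomology

end
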